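import Summits.AtomisticToContinuum.HydrodynamicLimit.Theorems.InformationPercolationEngineCollisionRate
import Summits.AtomisticToContinuum.HydrodynamicLimit.Theorems.InformationPercolationEngineCollisionRateTubeRegular
import Summits.AtomisticToContinuum.HydrodynamicLimit.Theorems.InformationPercolationEngineCollisionRateUnitMarkTruncationRung0
import Summits.AtomisticToContinuum.HydrodynamicLimit.Theorems.InformationPercolationEngineCollisionRateCylinderPullbackUnitRung0
import Summits.AtomisticToContinuum.HydrodynamicLimit.Theorems.InformationPercolationEngineCollisionRateMeanEnskogUnitRung0
import Summits.AtomisticToContinuum.HydrodynamicLimit.Theorems.InformationPercolationEngineCollisionRateFixedTimeVarianceUnitRung0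
import Summits.AtomisticToContinuum.HydrodynamicLimit.Theorems.InformationPercolationEngineCollisionRateRung0
import Summits.AtomisticToContinuum.HydrodynamicLimit.Theorems.JParityClosureEvenStressEnskogL2ToProbability
import Summits.AtomisticToContinuum.HydrodynamicLimit.Theorems.OneFlightGossipEngineCollisionActivityTailsAbnormalActivityStatics
import Literature.MathematicalPhysics.KineticTheory.EvenCollisionTubeFunctional
import Literature.Analysis.FluidPDE.HardSphereCollisionRecord
import Literature.MathematicalPhysics.KineticTheory.CollisionFluxMeanBoundNonStationary
import Literature.MathematicalPhysics.KineticTheory.CollisionFluxUpperBound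
import Literature.MathematicalPhysics.KineticTheory.ShortFlightCount
import Literature.MathematicalPhysics.KineticTheory.CollisionTubePullbackDefs
import HarnessLib

/-!
# stub_collisionMarkFluxLG_of_envelope (crux stmt-AtomisticToContinuum-13481 `InformationPercolationEngine.CollisionRate`, line `Sketch`)

**F2 · the pair collision-flux bound (Markov form) under the EVOLVED local Gibbs law, from the marginal envelope (A).**
General-profile twin of `Literature.MathematicalPhysics.KineticTheory.localGibbsLaw_collisionMarkSum_ge_le` (rung 0), whose
only use of the invariance of the canonical law was the stationarity step of the Campbell–Fatou window device. Here that step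
is replaced by the NON-stationary device `exists_measurable_majorant_collisionSum_of_forall_le` (window `[0, τ']`, start `0`,
mesh `τ'/M`): the collision sum of the free-flight-invariant mark `ofReal (b (v_i, v_j))` is dominated on the good set by a
measurable `g` with `∫ g dLG ≤ liminf_M M · B M`, where the one-window bound `B M = (N+1)² · C_A · 4 ε² (τ'/M) · I`,
`I = ∫ ‖w − v‖ b(v, w) d(γ ⊗ γ)`, holds under EVERY law `(Φ_r)_* LG`, `r ∈ [0, τ'] ⊆ [0, τ]`: by `lintegral_map_le` the
one-window functional of the ordered pair `(k, l)` (window event cut from the swept tubes `exists_sweptTube`, read in the pair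
coordinates `(x_k − x_l, v_k, v_l)`) is a measurable function of `(Φ_r z l, Φ_r z k)`, so the PAIR conjunct of (A) bounds its
mean by `C_A ×` its integral over the free reference law `(Haar ⊗ γ) ⊗ (Haar ⊗ γ)`, and that integral is STATIC
(`lintegral_pairTubeSet_indicator_le`: Tonelli with the position `x_k` innermost, the minimal-image lift inequality
`volume_setOf_exists_reprSym_add_latticeVec_mem_le` at base point `x_l`, the tube volume `4 ε² h ‖v_l − v_k‖`, `Haar(𝕋³) = 1`).
Markov on `g` (`meas_ge_le_lintegral_div`) and `liminf_M M · B M = (N+1)² C_A · 4 ε² τ' · I` give the conclusion with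
`C_F2 = 4 C_A` and the `σ₀, u, θ, N₀` of (A).

References: C. Cercignani, R. Illner, M. Pulvirenti, *The Mathematical Theory of Dilute Gases* (1994), §4.3, App. 4.A.
-/

open scoped BigOperators Topology Classical MeasureTheory ProbabilityTheory InnerProductSpace ENNReal
open Filter Set Function MeasureTheory
open Literature.Analysis.FluidPDE Literature.MathematicalPhysics.KineticTheory

namespace Summit.AtomisticToContinuum.HydrodynamicLimit.Theorems.CollisionRate

open Summit.AtomisticToContinuum.HydrodynamicLimit.Theorems.CollisionActivityTailsAbnormalActivityStatics
  (windowEvent pairTubeSet measurableSet_pairTubeSet measurableSet_windowEvent mem_windowEvent_of_contact)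

/-- **The static one-window bound on the pair reference space.** For a jointly measurable tube family `S` with
`vol (S u) ≤ c ‖u‖`, an s-finite velocity law `γ` and a measurable weight `A` of the two velocities, the integral over the free
pair reference law `(Haar ⊗ γ) ⊗ (Haar ⊗ γ)` (coordinates `((x_l, v_l), (x_k, v_k))`) of the pair-tube indicator read in the
pair coordinates `(x_k − x_l, v_k, v_l)` times `A (v_k, v_l)` is at most `c · ∫ ‖p.2 − p.1‖ A(p) d(γ ⊗ γ)(p)`: Tonelli with
`x_k` innermost, whose section has Haar measure `≤ vol (S (v_l − v_k))` through the minimal-image lift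
(`volume_setOf_exists_reprSym_add_latticeVec_mem_le` at base point `x_l`), then `Haar(𝕋³) = 1` for the idle `x_l`. -/
theorem lintegral_pairTubeSet_indicator_le (γ : Measure V3) [SFinite γ] {S : V3 → Set V3}
    (hSm : MeasurableSet {q : V3 × V3 | q.1 ∈ S q.2}) {c : ℝ}
    (hSvol : ∀ u, volume (S u) ≤ ENNReal.ofReal (c * ‖u‖)) {A : V3 × V3 → ℝ≥0∞} (hA : Measurable A) :
    ∫⁻ q : (T3 × V3) × (T3 × V3), (pairTubeSet S).indicator (fun q' => A q'.2) (q.2.1 - q.1.1, q.2.2, q.1.2)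
        ∂(((volume : Measure T3).prod γ).prod ((volume : Measure T3).prod γ)) ≤
      ENNReal.ofReal c * ∫⁻ p, ENNReal.ofReal ‖p.2 - p.1‖ * A p ∂(γ.prod γ) := by
  set T : Set (T3 × V3 × V3) := pairTubeSet S with hT
  have hTm : MeasurableSet T := measurableSet_pairTubeSet hSm
  have hSu : ∀ v : V3, MeasurableSet (S v) := fun v => hSm.preimage (measurable_id.prodMk measurable_const)
  set f : (T3 × V3) × (T3 × V3) → ℝ≥0∞ := fun q =>
    T.indicator (fun q' => A q'.2) (q.2.1 - q.1.1, q.2.2, q.1.2) with hf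
  have hfm : Measurable f :=
    ((hA.comp measurable_snd).indicator hTm).comp
      ((measurable_snd.fst.sub measurable_fst.fst).prodMk (measurable_snd.snd.prodMk measurable_fst.snd))
  set g : V3 → V3 → ℝ≥0∞ := fun v' v => ENNReal.ofReal c * (ENNReal.ofReal ‖v' - v‖ * A (v, v')) with hg
  have hgm : AEMeasurable (uncurry g) (γ.prod γ) := by
    refine Measurable.aemeasurable (measurable_const.mul ?_)
    exact (measurable_fst.sub measurable_snd).norm.ennreal_ofReal.mul
      (hA.comp (measurable_snd.prodMk measurable_fst))
  -- the innermost integral over the position `x_k`: the Haar measure of the section, through the minimal-image lift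
  have hinner : ∀ (y : T3) (v' v : V3), ∫⁻ x : T3, f ((y, v'), (x, v)) ≤ g v' v := by
    intro y v' v
    set sec : Set T3 := {x | (x - y, v, v') ∈ T} with hsec
    have hind : ∀ x : T3, f ((y, v'), (x, v)) = sec.indicator (fun _ => A (v, v')) x := by
      intro x
      by_cases hx : (x - y, v, v') ∈ T
      · have hx' : x ∈ sec := hx
        rw [indicator_of_mem hx', hf]
        exact indicator_of_mem hx _
      · have hx' : x ∉ sec := hx
        rw [indicator_of_notMem hx', hf]
        exact indicator_of_notMem hx _
    have hvol : volume sec ≤ volume (S (v' - v)) :=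
      volume_setOf_exists_reprSym_add_latticeVec_mem_le y (hSu (v' - v))
    calc ∫⁻ x : T3, f ((y, v'), (x, v)) = ∫⁻ x : T3, sec.indicator (fun _ => A (v, v')) x :=
          lintegral_congr hind
      _ ≤ A (v, v') * volume sec := lintegral_indicator_const_le _ _
      _ ≤ A (v, v') * ENNReal.ofReal (c * ‖v' - v‖) := by gcongr; exact hvol.trans (hSvol _)
      _ = g v' v := by rw [hg, ENNReal.ofReal_mul' (norm_nonneg _)]; ring
  -- the integral over `(x_k, v_k)` for a fixed `(x_l, v_l)`: Tonelli with the position innermost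
  have hmid : ∀ q₁ : T3 × V3, ∫⁻ q₂, f (q₁, q₂) ∂((volume : Measure T3).prod γ) ≤ ∫⁻ v, g q₁.2 v ∂γ := by
    intro q₁
    have hm : AEMeasurable (fun q₂ : T3 × V3 => f (q₁, q₂)) ((volume : Measure T3).prod γ) :=
      (hfm.comp (measurable_const.prodMk measurable_id)).aemeasurable
    rw [lintegral_prod_symm _ hm]
    exact lintegral_mono fun v => hinner q₁.1 q₁.2 v
  calc ∫⁻ q, f q ∂(((volume : Measure T3).prod γ).prod ((volume : Measure T3).prod γ))
      ≤ ∫⁻ q₁, ∫⁻ q₂, f (q₁, q₂) ∂((volume : Measure T3).prod γ) ∂((volume : Measure T3).prod γ) :=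
        lintegral_prod_le _
    _ ≤ ∫⁻ q₁, ∫⁻ v, g q₁.2 v ∂γ ∂((volume : Measure T3).prod γ) := lintegral_mono hmid
    _ ≤ ∫⁻ _y : T3, ∫⁻ v', ∫⁻ v, g v' v ∂γ ∂γ ∂volume := lintegral_prod_le _
    _ = ∫⁻ v', ∫⁻ v, g v' v ∂γ ∂γ := by rw [lintegral_const, measure_univ, mul_one]
    _ = ∫⁻ p, g p.2 p.1 ∂(γ.prod γ) := lintegral_lintegral_symm hgm
    _ = ENNReal.ofReal c * ∫⁻ p, ENNReal.ofReal ‖p.2 - p.1‖ * A p ∂(γ.prod γ) := by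
        rw [hg, ← lintegral_const_mul' _ _ ENNReal.ofReal_ne_top]

/-- **F2 · the pair collision-flux bound under the evolved local Gibbs law, from the marginal envelope (A)** (registered stub `stub_collisionMarkFluxLG_of_envelope` of crux stmt-AtomisticToContinuum-13481, line `Sketch`, skeleton v21): general-profile twin of `localGibbsLaw_collisionMarkSum_ge_le` (Markov form) with the stationarity step replaced by the non-stationary Campbell–Fatou device `exists_measurable_majorant_collisionSum_of_forall_le` and the one-window statics supplied by the pair conjunct of (A). [folklore] -/
theorem stub_collisionMarkFluxLG_of_envelope :
    (∀ (a₀ θ₀ : T3 → ℝ) (u₀ : T3 → V3), Continuous a₀ → Continuous θ₀ → Continuous u₀ →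
      (∀ x, 0 < a₀ x) → (∀ x, 0 < θ₀ x) → ∃ σ₀ : ℝ, 0 < σ₀ ∧ ∀ σ : ℝ, 0 < σ → σ < σ₀ →
      ∀ Φ : (N : ℕ) → HardSphereFlow (Torus.geometry (Fin 3)) (hsDiameter σ N) (N + 1),
      ∀ τ : ℝ, 0 < τ → ∃ C : ℝ, 0 ≤ C ∧ ∃ u : V3, ∃ θ : ℝ, 0 < θ ∧ ∃ N₀ : ℕ, ∀ N : ℕ, N₀ ≤ N →
      ∀ t ∈ Set.Icc (0 : ℝ) τ,
        (∀ i j : Fin (N + 1), i ≠ j → ∀ f : (T3 × V3) × (T3 × V3) → ℝ≥0∞, Measurable f →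
          ∫⁻ z, f ((Φ N).flow t z i, (Φ N).flow t z j) ∂(localGibbsLaw σ a₀ u₀ θ₀ N (Φ N)) ≤
            ENNReal.ofReal C * ∫⁻ q, f q ∂(((volume : Measure T3).prod (gaussMeasure u θ)).prod
              ((volume : Measure T3).prod (gaussMeasure u θ)))) ∧
        (∀ i j k : Fin (N + 1), i ≠ j → i ≠ k → j ≠ k → ∀ f : (T3 × V3) × (T3 × V3) × (T3 × V3) → ℝ≥0∞, Measurable f →
          ∫⁻ z, f ((Φ N).flow t z i, (Φ N).flow t z j, (Φ N).flow t z k) ∂(localGibbsLaw σ a₀ u₀ θ₀ N (Φ N)) ≤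
            ENNReal.ofReal C * ∫⁻ q, f q ∂(((volume : Measure T3).prod (gaussMeasure u θ)).prod
              (((volume : Measure T3).prod (gaussMeasure u θ)).prod ((volume : Measure T3).prod (gaussMeasure u θ)))))) →
    ∀ (a₀ θ₀ : T3 → ℝ) (u₀ : T3 → V3), Continuous a₀ → Continuous θ₀ → Continuous u₀ →
      (∀ x, 0 < a₀ x) → (∀ x, 0 < θ₀ x) → ∃ σ₀ : ℝ, 0 < σ₀ ∧ ∀ σ : ℝ, 0 < σ → σ < σ₀ →
      ∀ Φ : (N : ℕ) → HardSphereFlow (Torus.geometry (Fin 3)) (hsDiameter σ N) (N + 1),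
      ∀ τ : ℝ, 0 < τ → ∃ C : ℝ, 0 ≤ C ∧ ∃ u : V3, ∃ θ : ℝ, 0 < θ ∧ ∃ N₀ : ℕ, ∀ N : ℕ, N₀ ≤ N →
      ∀ τ' : ℝ, 0 < τ' → τ' ≤ τ → ∀ b : V3 × V3 → ℝ, Measurable b → (∀ p, 0 ≤ b p) → ∀ η : ℝ, 0 < η →
        localGibbsLaw σ a₀ u₀ θ₀ N (Φ N)
            {z | z ∈ (Φ N).good ∧ η ≤ ∑ᶠ s ∈ collisionTimes (Torus.geometry (Fin 3)) (hsDiameter σ N)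
                (fun t => (Φ N).flow t z) ∩ Set.Icc 0 τ',
              ∑ i : Fin (N + 1), ∑ j : Fin (N + 1),
                (if i ≠ j ∧ ‖(Torus.geometry (Fin 3)).sepVec ((Φ N).flow s z i).1 ((Φ N).flow s z j).1‖ =
                    hsDiameter σ N then b (((Φ N).flow s z i).2, ((Φ N).flow s z j).2) else 0)} ≤
          (ENNReal.ofReal η)⁻¹ * (ENNReal.ofReal (C * τ' * ((N + 1 : ℕ) : ℝ) ^ 2 * hsDiameter σ N ^ 2) *
            ∫⁻ p, ENNReal.ofReal (‖p.2 - p.1‖ * b p) ∂((gaussMeasure u θ).prod (gaussMeasure u θ))) := by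
  intro hA a₀ θ₀ u₀ ha hθ hu ha0 hθ0
  obtain ⟨σ₀, hσ₀, hA'⟩ := hA a₀ θ₀ u₀ ha hθ hu ha0 hθ0
  refine ⟨σ₀, hσ₀, fun σ hσ hσlt Φ τ hτ => ?_⟩
  obtain ⟨C, hC, u, θ, hθpos, N₀, hN⟩ := hA' σ hσ hσlt Φ τ hτ
  refine ⟨4 * C, by positivity, u, θ, hθpos, N₀, fun N hNN τ' hτ' hτ'τ b hbm hb0 η hη => ?_⟩
  -- abbreviations
  set ε : ℝ := hsDiameter σ N with hεdef
  have hε : 0 < ε := hsDiameter_pos hσ N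
  set P : Measure (Config (N + 1) (Fin 3) T3) := localGibbsLaw σ a₀ u₀ θ₀ N (Φ N) with hPdef
  set γ : Measure V3 := gaussMeasure u θ with hγdef
  set A : V3 × V3 → ℝ≥0∞ := fun p => ENNReal.ofReal (b p) with hAdef
  have hAm : Measurable A := hbm.ennreal_ofReal
  set I : ℝ≥0∞ := ∫⁻ p, ENNReal.ofReal ‖p.2 - p.1‖ * A p ∂(γ.prod γ) with hIdef
  have hI : ∫⁻ p, ENNReal.ofReal (‖p.2 - p.1‖ * b p) ∂(γ.prod γ) = I :=
    lintegral_congr fun p => by rw [hAdef, ENNReal.ofReal_mul (norm_nonneg _)]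
  rw [hI]
  -- the mark: a function of the two velocities, unchanged along free flight
  set F : Config (N + 1) (Fin 3) T3 → Fin (N + 1) → Fin (N + 1) → ℝ≥0∞ :=
    fun w i j => A ((w i).2, (w j).2) with hFdef
  have hFm : ∀ i j, Measurable fun w => F w i j :=
    fun i j => hAm.comp ((measurable_pi_apply i).snd.prodMk (measurable_pi_apply j).snd)
  have hFfree : ∀ (t : ℝ) (w : Config (N + 1) (Fin 3) T3) (i j : Fin (N + 1)),
      F (freeFlight (Torus.geometry (Fin 3)) (-t) w) i j = F w i j := by
    intro t w i j
    simp only [hFdef, freeFlight_apply]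
  -- the swept tubes of mesh `τ' / M` and the window events cut from them
  have htube : ∀ M : ℕ, ∃ S : V3 → Set V3, MeasurableSet {q : V3 × V3 | q.1 ∈ S q.2} ∧
      (∀ v, volume (S v) ≤ ENNReal.ofReal (4 * ε ^ 2 * (τ' / M) * ‖v‖)) ∧
      ∀ (v r : V3) (s : ℝ), ε ≤ ‖r‖ → s ∈ Icc 0 (τ' / M) → ‖r + s • v‖ = ε → r ∈ S v :=
    fun M => exists_sweptTube hε (div_nonneg hτ'.le (Nat.cast_nonneg M))
  choose S hSm hSvol hS using htube
  set E : ℕ → Fin (N + 1) → Fin (N + 1) → Set (Config (N + 1) (Fin 3) T3) :=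
    fun M k l => windowEvent (S M) k l with hE
  set n : ℝ≥0∞ := ((N + 1 : ℕ) : ℝ≥0∞) with hn
  set B : ℕ → ℝ≥0∞ := fun M =>
    n * n * (ENNReal.ofReal C * (ENNReal.ofReal (4 * ε ^ 2 * (τ' / M)) * I)) with hB
  -- the one-window bound of ONE ordered pair under the law at a time `r ∈ [0, τ]`: pair conjunct of (A) + statics
  have hterm : ∀ (M : ℕ), ∀ r ∈ Icc (0 : ℝ) τ, ∀ k l : Fin (N + 1), k ≠ l →
      ∫⁻ x, (E M k l).indicator (fun x => F x k l) x ∂(P.map ((Φ N).flow r)) ≤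
        ENNReal.ofReal C * (ENNReal.ofReal (4 * ε ^ 2 * (τ' / M)) * I) := by
    intro M r hr k l hkl
    set f : (T3 × V3) × (T3 × V3) → ℝ≥0∞ := fun q =>
      (pairTubeSet (S M)).indicator (fun q' => A q'.2) (q.2.1 - q.1.1, q.2.2, q.1.2) with hf
    have hfm : Measurable f :=
      ((hAm.comp measurable_snd).indicator (measurableSet_pairTubeSet (hSm M))).comp
        ((measurable_snd.fst.sub measurable_fst.fst).prodMk (measurable_snd.snd.prodMk measurable_fst.snd))
    have hpt : ∀ w : Config (N + 1) (Fin 3) T3, (E M k l).indicator (fun x => F x k l) w = f (w l, w k) := by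
      intro w
      by_cases hw : w ∈ E M k l
      · have hw' : ((w k).1 - (w l).1, (w k).2, (w l).2) ∈ pairTubeSet (S M) := hw
        rw [indicator_of_mem hw, hf]
        exact (indicator_of_mem hw' fun q' : T3 × V3 × V3 => A q'.2).symm
      · have hw' : ((w k).1 - (w l).1, (w k).2, (w l).2) ∉ pairTubeSet (S M) := hw
        rw [indicator_of_notMem hw, hf]
        exact (indicator_of_notMem hw' fun q' : T3 × V3 × V3 => A q'.2).symm
    calc ∫⁻ x, (E M k l).indicator (fun x => F x k l) x ∂(P.map ((Φ N).flow r))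
        ≤ ∫⁻ z, (E M k l).indicator (fun x => F x k l) ((Φ N).flow r z) ∂P := lintegral_map_le _ _
      _ = ∫⁻ z, f ((Φ N).flow r z l, (Φ N).flow r z k) ∂P := lintegral_congr fun z => hpt _
      _ ≤ ENNReal.ofReal C * ∫⁻ q, f q ∂(((volume : Measure T3).prod γ).prod ((volume : Measure T3).prod γ)) :=
          (hN N hNN r hr).1 l k hkl.symm f hfm
      _ ≤ ENNReal.ofReal C * (ENNReal.ofReal (4 * ε ^ 2 * (τ' / M)) * I) := by
          gcongr
          exact lintegral_pairTubeSet_indicator_le γ (hSm M) (hSvol M) hAm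
  -- the one-window bound under the laws at ALL times of the window `[0, τ'] ⊆ [0, τ]`
  have hBle : ∀ (M : ℕ), ∀ r ∈ Icc (0 : ℝ) (0 + τ'),
      ∫⁻ x, ∑ k : Fin (N + 1), ∑ l : Fin (N + 1),
        (if k ≠ l then (E M k l).indicator (fun x => F x k l) x else 0) ∂(P.map ((Φ N).flow r)) ≤ B M := by
    intro M r hr
    have hr' : r ∈ Icc (0 : ℝ) τ := ⟨hr.1, by linarith [hr.2]⟩
    have hterm' : ∀ k l : Fin (N + 1), ∫⁻ x, (if k ≠ l then (E M k l).indicator (fun x => F x k l) x else 0)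
        ∂(P.map ((Φ N).flow r)) ≤ ENNReal.ofReal C * (ENNReal.ofReal (4 * ε ^ 2 * (τ' / M)) * I) := by
      intro k l
      by_cases hkl : k ≠ l
      · simp only [if_pos hkl]; exact hterm M r hr' k l hkl
      · simp only [if_neg hkl, lintegral_zero, zero_le]
    have hmeas : ∀ k l : Fin (N + 1), Measurable fun x : Config (N + 1) (Fin 3) T3 =>
        (if k ≠ l then (E M k l).indicator (fun x => F x k l) x else 0) := by
      intro k l
      by_cases hkl : k ≠ l
      · simp only [if_pos hkl]; exact (hFm k l).indicator (measurableSet_windowEvent (hSm M) k l)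
      · simp only [if_neg hkl]; exact measurable_const
    calc _ = ∑ k : Fin (N + 1), ∑ l : Fin (N + 1), ∫⁻ x, (if k ≠ l then (E M k l).indicator (fun x => F x k l) x else 0)
          ∂(P.map ((Φ N).flow r)) := by
          rw [lintegral_finsetSum _ fun k _ => Finset.measurable_sum _ fun l _ => hmeas k l]
          exact Finset.sum_congr rfl fun k _ => lintegral_finsetSum _ fun l _ => hmeas k l
      _ ≤ ∑ _k : Fin (N + 1), ∑ _l : Fin (N + 1), ENNReal.ofReal C * (ENNReal.ofReal (4 * ε ^ 2 * (τ' / M)) * I) :=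
          Finset.sum_le_sum fun k _ => Finset.sum_le_sum fun l _ => hterm' k l
      _ = B M := by
          simp only [Finset.sum_const, Finset.card_univ, Fintype.card_fin, nsmul_eq_mul, hB, hn]; ring
  -- the window inequality: a measurable majorant of the marked collision sum over `[0, τ']`
  obtain ⟨g, hgm, hdom, hint⟩ := exists_measurable_majorant_collisionSum_of_forall_le (Φ N) P hτ' 0
    F E (fun M k l => measurableSet_windowEvent (hSm M) k l)
    (fun M k l hkl x hx t' ht' hc => mem_windowEvent_of_contact (hS M) hkl hx ht' hc)
    (fun _ => F) (fun _ k l => hFm k l)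
    (fun M k l _ x _ t' _ _ => (hFfree t' x k l).le) B hBle
  -- `liminf_M M · B M ≤ (N+1)² C · 4 ε² τ' · I`
  set L : ℝ≥0∞ := n * n * (ENNReal.ofReal C * (ENNReal.ofReal (4 * ε ^ 2 * τ') * I)) with hL
  have hMB : ∀ M : ℕ, 1 ≤ M → (M : ℝ≥0∞) * B M = L := by
    intro M hM
    have hM0 : (0 : ℝ) < M := by exact_mod_cast hM
    have hkey : (M : ℝ≥0∞) * ENNReal.ofReal (4 * ε ^ 2 * (τ' / M)) = ENNReal.ofReal (4 * ε ^ 2 * τ') := by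
      rw [← ENNReal.ofReal_natCast, ← ENNReal.ofReal_mul (Nat.cast_nonneg M)]
      congr 1; field_simp
    rw [hB, hL, ← hkey]; ring
  have hlim : liminf (fun M : ℕ => (M : ℝ≥0∞) * B M) atTop ≤ L :=
    liminf_le_of_frequently_le' (((eventually_ge_atTop 1).mono fun M hM => (hMB M hM).le).frequently)
  -- the constants: `(N+1)² · C · 4 ε² τ' = (4 C) τ' (N+1)² ε²`
  have hconst : L = ENNReal.ofReal (4 * C * τ' * ((N + 1 : ℕ) : ℝ) ^ 2 * ε ^ 2) * I := by
    have hn' : n = ENNReal.ofReal ((N + 1 : ℕ) : ℝ) := by rw [hn, ENNReal.ofReal_natCast]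
    have hm0 : (0 : ℝ) ≤ ((N + 1 : ℕ) : ℝ) := Nat.cast_nonneg _
    have hreal : ((N + 1 : ℕ) : ℝ) * ((N + 1 : ℕ) : ℝ) * C * (4 * ε ^ 2 * τ') =
        4 * C * τ' * ((N + 1 : ℕ) : ℝ) ^ 2 * ε ^ 2 := by ring
    calc L = n * n * ENNReal.ofReal C * ENNReal.ofReal (4 * ε ^ 2 * τ') * I := by rw [hL]; ring
      _ = ENNReal.ofReal (((N + 1 : ℕ) : ℝ) * ((N + 1 : ℕ) : ℝ) * C * (4 * ε ^ 2 * τ')) * I := by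
          rw [hn', ← ENNReal.ofReal_mul hm0, ← ENNReal.ofReal_mul (mul_nonneg hm0 hm0),
            ← ENNReal.ofReal_mul (mul_nonneg (mul_nonneg hm0 hm0) hC)]
      _ = _ := by rw [hreal]
  -- Markov on the majorant: the event is contained in `{ofReal η ≤ g}`
  have hη0 : ENNReal.ofReal η ≠ 0 := (ENNReal.ofReal_pos.2 hη).ne'
  have hsub : {z | z ∈ (Φ N).good ∧ η ≤ ∑ᶠ s ∈ collisionTimes (Torus.geometry (Fin 3)) (hsDiameter σ N)
        (fun t => (Φ N).flow t z) ∩ Set.Icc 0 τ',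
      ∑ i : Fin (N + 1), ∑ j : Fin (N + 1),
        (if i ≠ j ∧ ‖(Torus.geometry (Fin 3)).sepVec ((Φ N).flow s z i).1 ((Φ N).flow s z j).1‖ =
            hsDiameter σ N then b (((Φ N).flow s z i).2, ((Φ N).flow s z j).2) else 0)} ⊆
      {z | ENNReal.ofReal η ≤ g z} := by
    rintro z ⟨hz, hle⟩
    have hdz := hdom z hz
    rw [zero_add] at hdz
    refine (ENNReal.ofReal_le_ofReal hle).trans ((le_of_eq ?_).trans hdz)
    have hfin := ((Φ N).isTrajectory z hz).locFinite 0 τ'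
    rw [finsum_mem_eq_finite_toFinset_sum _ hfin, finsum_mem_eq_finite_toFinset_sum _ hfin]
    rw [ENNReal.ofReal_sum_of_nonneg fun s _ => Finset.sum_nonneg fun i _ =>
      Finset.sum_nonneg fun j _ => by split_ifs <;> simp [hb0]]
    refine Finset.sum_congr rfl fun s _ => ?_
    rw [ENNReal.ofReal_sum_of_nonneg fun i _ => Finset.sum_nonneg fun j _ => by split_ifs <;> simp [hb0]]
    refine Finset.sum_congr rfl fun i _ => ?_
    rw [ENNReal.ofReal_sum_of_nonneg fun j _ => by split_ifs <;> simp [hb0]]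
    refine Finset.sum_congr rfl fun j _ => ?_
    rw [apply_ite ENNReal.ofReal, ENNReal.ofReal_zero]
  calc P _ ≤ P {z | ENNReal.ofReal η ≤ g z} := measure_mono hsub
    _ ≤ (∫⁻ z, g z ∂P) / ENNReal.ofReal η := meas_ge_le_lintegral_div hgm.aemeasurable hη0 ENNReal.ofReal_ne_top
    _ = (ENNReal.ofReal η)⁻¹ * ∫⁻ z, g z ∂P := by rw [ENNReal.div_eq_inv_mul]
    _ ≤ (ENNReal.ofReal η)⁻¹ * L := by gcongr; exact hint.trans hlim
    _ = (ENNReal.ofReal η)⁻¹ * (ENNReal.ofReal (4 * C * τ' * ((N + 1 : ℕ) : ℝ) ^ 2 * ε ^ 2) * I) := by rw [hconst]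

end Summit.AtomisticToContinuum.HydrodynamicLimit.Theorems.CollisionRate
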